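import Mathlib
import HarnessLib
import Summits.HubbardSuperconductivity.HubbardSuperconductivity.Theorems.KLProgrammeMatsubaraSoftPartnerSignBlind
import Summits.HubbardSuperconductivity.HubbardSuperconductivity.Theorems.KLProgrammeRadialMassPlanar

/-!
# Route `KLProgramme` — crux K3, ENGINE child gen 6 (stmt-HubbardSuperconductivity-20236 `KLRegimeEngineV16`), stub `stub_engine_step_values`,
# (E2-v10) ph-loop inputs: the β-UNIFORM sign-blind slice ⊗ SOFT-partner bubble of the FRAME BAND ON THE PLANE (continuum momentum,
# discrete Matsubara sum), any bosonic frequency transfer (cell gate-hubbard-kl, seat hubbard-kl-k3c2-p2 g7)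

Sequel to `…MatsubaraSoftPartnerSignBlind` (per ray) in the geometry of `…ForwardBubbleRay/Planar` (p485589/p486082): the loop momentum runs over the
plane, the first line is a SLICE-type weight `f` of the frame band `e = klfb_band δ μ` (window `[Λ_n/2, 4Λ_n]`), the partner is a SOFT weight `d`
(`‖d‖ ≤ M′`, Lipschitz, NO inner radius) read at the shifted band `e′` and at the shifted frequency `ω_i + q₀`, `q₀ = 2πm₀/β`, and the vertex
weight `A_i(p)` may depend on the loop frequency.  Per ray the coarea (`klfb_ray_integral_eq`) turns the integrand into
`W_{θ,i}(e)·Φ_f(ω_i,e)·Φ_d(ω_i+q₀, e + σ_θ(e))` with `W = 𝒥·A_i(ray point)` (`‖W‖ ≤ A₀π√2/d`, `klfb_weight_norm_le`) and the shift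
`σ_θ = klfb_shift δ μ e′ θ`; `klhs_slice_soft_signblind_norm_le_window` then gives the ray bound `(512/π)·M_f·(A₀π√2/d)·M′` as soon as
`σ_θ` is `½`-Lipschitz on the window `[−4Λ_n, 4Λ_n]` (a hypothesis: the transfer-shifted band has slope in `[½, 3/2]` along the rays — small and
moderate momentum transfers), and the angle integration (`klry_norm_smul_sum_integral_le_of_ray_bound`) multiplies by `2π`:

* `klhp_continuous_prop_of_ne` (the soft propagator `e ↦ Φ_d(k₀,e)` is continuous at `k₀ ≠ 0`),
  `klhp_continuous_integrand`, `klhp_ray_integral_eq` (one ray in level coordinates, soft partner allowed);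
* **`klhp_ray_soft_signblind_norm_le`** (per ray) and **`klhp_planar_soft_signblind_norm_le`**:
  `‖β⁻¹ • Σ_i ∫ d²p A_i(p)·Φ_f(ω_i, e(p))·Φ_d(ω_i + 2πm₀/β, e′(p))‖ ≤ 2π·(512/π)·M_f·(A₀·π√2/(Dt_min − κ₁))·M′`,
  uniformly in `β ≥ klBetaMin`, `n ≤ n_β + 1`, `M`, `m₀` and the partner band.

Pure analysis; nothing about the model's effective action is asserted; nothing asserts superconductivity.
-/

noncomputable section

namespace Summit.HubbardSuperconductivity.HubbardSuperconductivity.Theorems.KLRegimeSplit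

set_option linter.dupNamespace false -- summit = problem name (single-conjunct summit), D-0017

open Real Set Filter MeasureTheory intervalIntegral Complex Literature.MathematicalPhysics.QuantumLattice
open Literature.MathematicalPhysics.QuantumLattice.BandSectorCounting Literature.Probability.LatticeModels
open Summit.HubbardSuperconductivity.HubbardSuperconductivity.Theorems.PerturbedFermiCurve
open Summit.HubbardSuperconductivity.HubbardSuperconductivity.Theorems.KLProgrammeLegKernels
open Summit.HubbardSuperconductivity.HubbardSuperconductivity.Theorems.DispersionFlow

/-! ## §1 Continuity of the soft propagator at a nonzero frequency -/

/-- **The soft propagator is continuous in `e` at a nonzero frequency**: `e ↦ Φ_d(k₀, e) = d(s)/s·(ik₀+e)`, `s = k₀² + e² ≥ k₀² > 0`. -/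
theorem klhp_continuous_prop_of_ne {d : ℝ → ℂ} {L : ℝ} (hlip : ∀ s s', ‖d s - d s'‖ ≤ L * |s - s'|) {k₀ : ℝ} (hk : k₀ ≠ 0) :
    Continuous fun e : ℝ => klfb_prop d k₀ e := by
  have hd := klrp_continuous_of_lipschitz hlip
  have hs : Continuous fun e : ℝ => k₀ ^ 2 + e ^ 2 := continuous_const.add (continuous_id.pow 2)
  unfold klfb_prop
  refine ((hd.comp hs).div (Complex.continuous_ofReal.comp hs) fun e => ?_).mul (continuous_const.add Complex.continuous_ofReal)
  have : (0 : ℝ) < k₀ ^ 2 + e ^ 2 := by positivity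
  show ((k₀ ^ 2 + e ^ 2 : ℝ) : ℂ) ≠ 0
  exact_mod_cast this.ne'

section Frame

variable {a b : ℝ} (B : BandBounds a b) {δ : (Fin 2 → ℝ) → ℝ} (hδ1 : ContDiff ℝ 1 δ) {κ₀ κ₁ : ℝ}
  (hδ : ∀ k : Fin 2 → ℝ, (∀ i, |k i| ≤ π) → |δ k| ≤ κ₀)
  (hκ : ∀ k : Fin 2 → ℝ, (∀ i, |k i| ≤ π) → ‖fderiv ℝ δ k‖ ≤ κ₁) (hκ₁ : κ₁ < B.Dtmin)

/-! ## §2 The integrand with a soft partner: continuity and one ray in level coordinates -/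

omit B in
/-- **Continuity of the planar integrand with a soft partner** (continuous `A`, `δ`, `e′`; slice weight `f` with inner/outer radii; soft weight `d`
Lipschitz; partner frequency `k₀ + q₀ ≠ 0`). -/
theorem klhp_continuous_integrand (hδc : Continuous δ) {A : ℝ × ℝ → ℂ} (hA : Continuous A) {f d : ℝ → ℂ} {Lf Mf Ld r₁ r₂ : ℝ}
    (hlip : ∀ s s', ‖f s - f s'‖ ≤ Lf * |s - s'|) (hbd : ∀ s, ‖f s‖ ≤ Mf) (hin : ∀ s, s ≤ r₁ ^ 2 → f s = 0)
    (hout : ∀ s, r₂ ^ 2 ≤ s → f s = 0) (hr₁ : 0 < r₁) (hr₂ : 0 < r₂)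
    (hdlip : ∀ s s', ‖d s - d s'‖ ≤ Ld * |s - s'|) {e' : ℝ × ℝ → ℝ} (he' : Continuous e') (μ : ℝ) {k₀ q₀ : ℝ} (hk : k₀ + q₀ ≠ 0) :
    Continuous (klfb_integrand δ μ A f d e' k₀ q₀) := by
  unfold klfb_integrand
  exact (hA.mul ((klfb_continuous_prop_snd hlip hbd hin hout hr₁ hr₂ k₀).comp (klfb_continuous_band hδc μ))).mul
    ((klhp_continuous_prop_of_ne hdlip hk).comp he')

include B hδ1 hδ hκ hκ₁ in
/-- **One ray in level coordinates, soft partner.**  `∫_{t>0} t • h(t cos θ, t sin θ) dt = ∫ W_θ(e)·Φ_f(k₀,e)·Φ_d(k₀+q₀, e + σ_θ(e)) de`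
for the integrand `h = klfb_integrand δ μ A f d e′ k₀ q₀` with `k₀ + q₀ ≠ 0` (tube radius `r`: `f(s) = 0` for `s ≥ r²`; margin window). -/
theorem klhp_ray_integral_eq {A : ℝ × ℝ → ℂ} (hA : Continuous A) (hAsupp : ∀ p : ℝ × ℝ, A p ≠ 0 → |p.1| < π ∧ |p.2| < π)
    {f d : ℝ → ℂ} {Lf Mf Ld r₁ r : ℝ}
    (hlip : ∀ s s', ‖f s - f s'‖ ≤ Lf * |s - s'|) (hbd : ∀ s, ‖f s‖ ≤ Mf) (hin : ∀ s, s ≤ r₁ ^ 2 → f s = 0)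
    (hout : ∀ s, r ^ 2 ≤ s → f s = 0) (hr₁ : 0 < r₁) (hr : 0 < r)
    (hdlip : ∀ s s', ‖d s - d s'‖ ≤ Ld * |s - s'|)
    {e' : ℝ × ℝ → ℝ} (he' : Continuous e') {μ : ℝ} (hlo : a < μ - r - κ₀) (hhi : μ + r + κ₀ < b) {k₀ q₀ : ℝ} (hk : k₀ + q₀ ≠ 0) (θ : ℝ) :
    ∫ t in Ioi (0 : ℝ), t • klfb_integrand δ μ A f d e' k₀ q₀ (t * Real.cos θ, t * Real.sin θ) =
      ∫ e : ℝ, klfb_weight δ μ A θ e * klfb_prop f k₀ e * klfb_prop d (k₀ + q₀) (e + klfb_shift δ μ e' θ e) := by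
  have hδc : Continuous δ := hδ1.continuous
  have hc := klhp_continuous_integrand hδc hA hlip hbd hin hout hr₁ hr hdlip he' μ hk
  rw [klfb_ray_integral_eq B hδ1 hδ hκ hκ₁ hc hr.le hlo hhi (klfb_integrand_support hAsupp hr.le hout e' μ k₀ q₀) θ]
  have hwin : ∀ e ∈ uIcc (-r) r, klfb_jac δ μ θ e • klfb_integrand δ μ A f d e' k₀ q₀ (klfb_rayPt δ μ θ e) =
      klfb_weight δ μ A θ e * klfb_prop f k₀ e * klfb_prop d (k₀ + q₀) (e + klfb_shift δ μ e' θ e) := by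
    intro e he
    rw [uIcc_of_le (by linarith)] at he
    have hlo' : a ≤ μ + e - κ₀ := by linarith [he.1]
    have hhi' : μ + e + κ₀ ≤ b := by linarith [he.2]
    unfold klfb_integrand klfb_weight klfb_shift
    rw [klfb_band_rayPt B hδ hδc hlo' hhi' θ, add_sub_cancel, Complex.real_smul]
    ring
  rw [intervalIntegral.integral_congr hwin]
  refine intervalIntegral.integral_eq_integral_of_support_subset fun e he => ?_
  by_contra hnot
  apply he
  have hge : r ≤ |e| := by
    by_contra hlt
    push Not at hlt
    exact hnot ⟨by linarith [neg_abs_le e], (le_abs_self e).trans hlt.le⟩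
  simp only [klfb_prop_eq_zero_of_le_abs hr.le hout k₀ hge, mul_zero, zero_mul]

/-! ## §3 The per-ray and the planar sign-blind bounds -/

omit B in
/-- The partner frequency at a bosonic transfer: `ω_i + 2πm₀/β = π(2(n_i + m₀) + 1)/β`. -/
theorem klhp_matsubaraFreq_add_bosonic (β : ℝ) (M : ℕ) (i : MatsubaraIdx M) (m₀ : ℤ) :
    matsubaraFreq β M i + 2 * Real.pi * (m₀ : ℝ) / β = Real.pi * (2 * ((matsubaraInt M i + m₀ : ℤ) : ℝ) + 1) / β := by
  rw [matsubaraFreq]; push_cast; ring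

include B hδ1 hδ hκ hκ₁ in
/-- **PER-RAY sign-blind slice ⊗ soft bubble, β-uniform.**  Data: frequency-dependent vertex weights `A_i` (continuous, supported in the open
square, `‖A_i‖ ≤ A₀`); the slice-`n` weight `f` (Lipschitz, `‖f‖ ≤ M_f`, `f = 0` for `s ≤ (Λ_n/2)²` and for `s ≥ (4Λ_n)²`); a soft weight `d`
(Lipschitz, `‖d‖ ≤ M′`); a continuous shifted band `e′` whose ray shift `σ_θ = klfb_shift δ μ e′ θ` is `½`-Lipschitz on `[−4Λ_n, 4Λ_n]`; the margin
window; `β ≥ klBetaMin`, `n ≤ n_β+1`, any `M`, bosonic transfer `q₀ = 2πm₀/β`.  Then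
`‖β⁻¹ • Σ_i ∫_{t>0} t • h_i(t cos θ, t sin θ) dt‖ ≤ (512/π)·M_f·((A₀·π√2/(Dt_min − κ₁))·M′)`. -/
theorem klhp_ray_soft_signblind_norm_le {M : ℕ} {A : MatsubaraIdx M → ℝ × ℝ → ℂ} (hA : ∀ i, Continuous (A i))
    (hAsupp : ∀ i, ∀ p : ℝ × ℝ, A i p ≠ 0 → |p.1| < π ∧ |p.2| < π) {A₀ : ℝ} (hA00 : 0 ≤ A₀) (hA0 : ∀ i p, ‖A i p‖ ≤ A₀)
    {f d : ℝ → ℂ} {Lf Mf Ld M' : ℝ} {n : ℕ}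
    (hlip : ∀ s s', ‖f s - f s'‖ ≤ Lf * |s - s'|) (hbd : ∀ s, ‖f s‖ ≤ Mf)
    (hin : ∀ s, s ≤ (klScale klE0 n / 2) ^ 2 → f s = 0) (hout : ∀ s, (4 * klScale klE0 n) ^ 2 ≤ s → f s = 0)
    (hdlip : ∀ s s', ‖d s - d s'‖ ≤ Ld * |s - s'|) (hdbd : ∀ s, ‖d s‖ ≤ M')
    {e' : ℝ × ℝ → ℝ} (he' : Continuous e') {μ : ℝ} (θ : ℝ)
    (hσ : ∀ e ∈ Icc (-(4 * klScale klE0 n)) (4 * klScale klE0 n), ∀ e'' ∈ Icc (-(4 * klScale klE0 n)) (4 * klScale klE0 n),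
      |klfb_shift δ μ e' θ e - klfb_shift δ μ e' θ e''| ≤ |e - e''| / 2)
    (hlo : a < μ - 4 * klScale klE0 n - κ₀) (hhi : μ + 4 * klScale klE0 n + κ₀ < b)
    {β : ℝ} (hβ : klBetaMin ≤ β) (hn : n ≤ nScales β + 1) (m₀ : ℤ) :
    ‖β⁻¹ • ∑ i : MatsubaraIdx M, ∫ t in Ioi (0 : ℝ),
        t • klfb_integrand δ μ (A i) f d e' (matsubaraFreq β M i) (2 * Real.pi * (m₀ : ℝ) / β) (t * Real.cos θ, t * Real.sin θ)‖ ≤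
      512 / Real.pi * Mf * (A₀ * (Real.pi * Real.sqrt 2 / (B.Dtmin - κ₁)) * M') := by
  have hδc : Continuous δ := hδ1.continuous
  have hΛ := klth_klScale_pos n
  have hβ0 : 0 < β := pos_of_klBetaMin_le hβ
  have hr₁ : 0 < klScale klE0 n / 2 := by positivity
  have hr : 0 < 4 * klScale klE0 n := by positivity
  have hd0 : 0 < B.Dtmin - κ₁ := by linarith
  have hM' : 0 ≤ M' := (norm_nonneg _).trans (hdbd 0)
  have hB0 : 0 ≤ A₀ * (Real.pi * Real.sqrt 2 / (B.Dtmin - κ₁)) * M' := by positivity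
  set q₀ : ℝ := 2 * Real.pi * (m₀ : ℝ) / β with hq₀
  -- the partner frequency is fermionic, hence nonzero
  have hν : ∀ i : MatsubaraIdx M, matsubaraFreq β M i + q₀ = Real.pi * (2 * ((matsubaraInt M i + m₀ : ℤ) : ℝ) + 1) / β :=
    fun i => klhp_matsubaraFreq_add_bosonic β M i m₀
  have hν0 : ∀ i : MatsubaraIdx M, matsubaraFreq β M i + q₀ ≠ 0 := by
    intro i
    rw [hν i]
    have hodd : (2 * ((matsubaraInt M i + m₀ : ℤ) : ℝ) + 1) ≠ 0 := by
      have h : (2 * (matsubaraInt M i + m₀) + 1 : ℤ) ≠ 0 := by omega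
      exact_mod_cast h
    exact div_ne_zero (mul_ne_zero Real.pi_pos.ne' hodd) hβ0.ne'
  -- per ray, in level coordinates
  have hray : ∀ i : MatsubaraIdx M,
      ∫ t in Ioi (0 : ℝ), t • klfb_integrand δ μ (A i) f d e' (matsubaraFreq β M i) q₀ (t * Real.cos θ, t * Real.sin θ) =
        ∫ e : ℝ, (f (matsubaraFreq β M i ^ 2 + e ^ 2) / (((matsubaraFreq β M i ^ 2 + e ^ 2 : ℝ)) : ℂ) * (I * (matsubaraFreq β M i) + e)) *
          (klfb_weight δ μ (A i) θ e * klfb_prop d (matsubaraFreq β M i + q₀) (e + klfb_shift δ μ e' θ e)) := by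
    intro i
    rw [klhp_ray_integral_eq B hδ1 hδ hκ hκ₁ (hA i) (hAsupp i) hlip hbd hin hout hr₁ hr hdlip he' hlo hhi (hν0 i) θ]
    congr 1
    funext e
    rw [klfb_prop_apply f]
    ring
  -- the partner hypothesis of `klhs_…_window`
  have hG : ∀ (i : MatsubaraIdx M) (e : ℝ), |e| < 4 * klScale klE0 n →
      ‖klfb_weight δ μ (A i) θ e * klfb_prop d (matsubaraFreq β M i + q₀) (e + klfb_shift δ μ e' θ e)‖ ≤
        A₀ * (Real.pi * Real.sqrt 2 / (B.Dtmin - κ₁)) * M' /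
          Real.sqrt ((Real.pi * (2 * ((matsubaraInt M i + m₀ : ℤ) : ℝ) + 1) / β) ^ 2 + (e + klfb_shift δ μ e' θ e) ^ 2) := by
    intro i e he
    have habs := abs_lt.mp he
    have hlo' : a ≤ μ + e - κ₀ := by linarith [habs.1]
    have hhi' : μ + e + κ₀ ≤ b := by linarith [habs.2]
    have hW := klfb_weight_norm_le B hδ hκ hκ₁ hδc (hA0 i) hlo' hhi' θ
    have hD := klhs_soft_propagator_norm_le hdbd (hν0 i) (e + klfb_shift δ μ e' θ e)
    rw [norm_mul, klfb_prop_apply, ← hν i]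
    have hW0 : 0 ≤ A₀ * (Real.pi * Real.sqrt 2 / (B.Dtmin - κ₁)) := by positivity
    calc ‖klfb_weight δ μ (A i) θ e‖ *
          ‖d ((matsubaraFreq β M i + q₀) ^ 2 + (e + klfb_shift δ μ e' θ e) ^ 2) /
              ((((matsubaraFreq β M i + q₀) ^ 2 + (e + klfb_shift δ μ e' θ e) ^ 2 : ℝ)) : ℂ) *
            (I * ((matsubaraFreq β M i + q₀ : ℝ) : ℂ) + ((e + klfb_shift δ μ e' θ e : ℝ) : ℂ))‖
        ≤ (A₀ * (Real.pi * Real.sqrt 2 / (B.Dtmin - κ₁))) *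
            (M' / Real.sqrt ((matsubaraFreq β M i + q₀) ^ 2 + (e + klfb_shift δ μ e' θ e) ^ 2)) :=
          mul_le_mul hW hD (norm_nonneg _) hW0
      _ = A₀ * (Real.pi * Real.sqrt 2 / (B.Dtmin - κ₁)) * M' /
            Real.sqrt ((matsubaraFreq β M i + q₀) ^ 2 + (e + klfb_shift δ μ e' θ e) ^ 2) := by ring
  have key := klhs_slice_soft_signblind_norm_le_window hbd hin hout hβ hn m₀ (σ := fun _ : MatsubaraIdx M => klfb_shift δ μ e' θ)
    (fun _ e he e'' he'' => hσ e he e'' he'')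
    (G := fun i e => klfb_weight δ μ (A i) θ e * klfb_prop d (matsubaraFreq β M i + q₀) (e + klfb_shift δ μ e' θ e)) hB0 hG
  calc ‖β⁻¹ • ∑ i : MatsubaraIdx M, ∫ t in Ioi (0 : ℝ),
          t • klfb_integrand δ μ (A i) f d e' (matsubaraFreq β M i) q₀ (t * Real.cos θ, t * Real.sin θ)‖
      = ‖β⁻¹ • ∑ i : MatsubaraIdx M, ∫ e : ℝ,
          (f (matsubaraFreq β M i ^ 2 + e ^ 2) / (((matsubaraFreq β M i ^ 2 + e ^ 2 : ℝ)) : ℂ) * (I * (matsubaraFreq β M i) + e)) *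
            (klfb_weight δ μ (A i) θ e * klfb_prop d (matsubaraFreq β M i + q₀) (e + klfb_shift δ μ e' θ e))‖ := by
        rw [Finset.sum_congr rfl fun i _ => hray i]
    _ ≤ 512 / Real.pi * Mf * (A₀ * (Real.pi * Real.sqrt 2 / (B.Dtmin - κ₁)) * M') := key

include B hδ1 hδ hκ hκ₁ in
/-- **THE SIGN-BLIND SLICE ⊗ SOFT BUBBLE OF THE FRAME BAND ON THE PLANE, β-UNIFORM** (angle integration of `klhp_ray_soft_signblind_norm_le`,
the ray shift `½`-Lipschitz on the window for every angle):
`‖β⁻¹ • Σ_i ∫ d²p A_i(p)·Φ_f(ω_i, e(p))·Φ_d(ω_i + 2πm₀/β, e′(p))‖ ≤ 2π·(512/π)·M_f·(A₀·π√2/(Dt_min − κ₁))·M′`. -/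
theorem klhp_planar_soft_signblind_norm_le {M : ℕ} {A : MatsubaraIdx M → ℝ × ℝ → ℂ} (hA : ∀ i, Continuous (A i))
    (hAsupp : ∀ i, ∀ p : ℝ × ℝ, A i p ≠ 0 → |p.1| < π ∧ |p.2| < π) {A₀ : ℝ} (hA00 : 0 ≤ A₀) (hA0 : ∀ i p, ‖A i p‖ ≤ A₀)
    {f d : ℝ → ℂ} {Lf Mf Ld M' : ℝ} {n : ℕ}
    (hlip : ∀ s s', ‖f s - f s'‖ ≤ Lf * |s - s'|) (hbd : ∀ s, ‖f s‖ ≤ Mf)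
    (hin : ∀ s, s ≤ (klScale klE0 n / 2) ^ 2 → f s = 0) (hout : ∀ s, (4 * klScale klE0 n) ^ 2 ≤ s → f s = 0)
    (hdlip : ∀ s s', ‖d s - d s'‖ ≤ Ld * |s - s'|) (hdbd : ∀ s, ‖d s‖ ≤ M')
    {e' : ℝ × ℝ → ℝ} (he' : Continuous e') {μ : ℝ}
    (hσ : ∀ θ : ℝ, ∀ e ∈ Icc (-(4 * klScale klE0 n)) (4 * klScale klE0 n), ∀ e'' ∈ Icc (-(4 * klScale klE0 n)) (4 * klScale klE0 n),
      |klfb_shift δ μ e' θ e - klfb_shift δ μ e' θ e''| ≤ |e - e''| / 2)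
    (hlo : a < μ - 4 * klScale klE0 n - κ₀) (hhi : μ + 4 * klScale klE0 n + κ₀ < b)
    {β : ℝ} (hβ : klBetaMin ≤ β) (hn : n ≤ nScales β + 1) (m₀ : ℤ) :
    ‖β⁻¹ • ∑ i : MatsubaraIdx M, ∫ p : ℝ × ℝ,
        klfb_integrand δ μ (A i) f d e' (matsubaraFreq β M i) (2 * Real.pi * (m₀ : ℝ) / β) p‖ ≤
      2 * Real.pi * (512 / Real.pi * Mf * (A₀ * (Real.pi * Real.sqrt 2 / (B.Dtmin - κ₁)) * M')) := by
  have hδc : Continuous δ := hδ1.continuous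
  have hΛ := klth_klScale_pos n
  have hβ0 : 0 < β := pos_of_klBetaMin_le hβ
  have hr₁ : 0 < klScale klE0 n / 2 := by positivity
  have hr : 0 < 4 * klScale klE0 n := by positivity
  have hν0 : ∀ i : MatsubaraIdx M, matsubaraFreq β M i + 2 * Real.pi * (m₀ : ℝ) / β ≠ 0 := by
    intro i
    rw [klhp_matsubaraFreq_add_bosonic β M i m₀]
    have hodd : (2 * ((matsubaraInt M i + m₀ : ℤ) : ℝ) + 1) ≠ 0 := by
      have h : (2 * (matsubaraInt M i + m₀) + 1 : ℤ) ≠ 0 := by omega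
      exact_mod_cast h
    exact div_ne_zero (mul_ne_zero Real.pi_pos.ne' hodd) hβ0.ne'
  have hint : ∀ i : MatsubaraIdx M,
      Integrable (klfb_integrand δ μ (A i) f d e' (matsubaraFreq β M i) (2 * Real.pi * (m₀ : ℝ) / β)) := by
    intro i
    have hc := klhp_continuous_integrand hδc (hA i) hlip hbd hin hout hr₁ hr hdlip he' μ (hν0 i)
    refine hc.integrable_of_hasCompactSupport ?_
    unfold klfb_integrand
    exact ((klfb_hasCompactSupport_of_square (hAsupp i)).mul_right).mul_right
  exact klry_norm_smul_sum_integral_le_of_ray_bound hint fun θ _ =>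
    klhp_ray_soft_signblind_norm_le B hδ1 hδ hκ hκ₁ hA hAsupp hA00 hA0 hlip hbd hin hout hdlip hdbd he' θ (hσ θ) hlo hhi hβ hn m₀

end Frame

end Summit.HubbardSuperconductivity.HubbardSuperconductivity.Theorems.KLRegimeSplit

end
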